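import Mathlib
import Literature.NumberTheory.Transcendental.KZRulesAssociator
import Summits.KontsevichZagierPeriods.KontsevichZagierPeriods.Theorems.InverseLandauTateLiftingBallValue
import Summits.KontsevichZagierPeriods.KontsevichZagierPeriods.Theorems.InverseLandauTateLiftingBallEven
import Summits.KontsevichZagierPeriods.KontsevichZagierPeriods.Theorems.InverseLandauTateLiftingBallOdd
import Summits.KontsevichZagierPeriods.KontsevichZagierPeriods.Theorems.InverseLandauTateLiftingPolydiscPow

/-!
# `TateLifting` (stmt-KontsevichZagierPeriods-9129), line `Sketch` — THE BALLS OF ALL DIMENSIONS AGAINST THE POWERS OF THE DISC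

Assembly of stubs 62–65 of the line (`tateLifting_ballValue`, `tateLifting_ballEven`, `tateLifting_ballOdd`,
`tateLifting_polydiscPow`), all identities INSIDE the Kontsevich–Zagier rules:

* `ballEven`, `ballOdd` — `k! · ⟦B̄₂ₖ⟧ = ⟦π⟧ᵏ` and `(2k+1)‼ · ⟦B̄₂ₖ₊₁⟧ = 2ᵏ⁺¹ · ⟦π⟧ᵏ` in the formal period ring
  `P = FormalRep ⧸ relations` (Lindemann read in `P`: `ball_mem_piSubring` + `transcRingKernel`; the values by
  `InnerProductSpace.volume_closedBall_of_dim_even/odd`);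
* `polydiscPow` — the closed polydisc `D̄ᵏ ⊂ ℝ²ᵏ` has the class `⟦π⟧ᵏ` (Fubini splitting, no transcendence input);
* `ballPolydisc` — **`k! · [B̄₂ₖ, 1] − [D̄ᵏ, 1] ∈ KZ.relations` for every `k`**;
* `ballCalibration`, `ballCalibrationSix` — route EulerFormChain's `BallCalibration` (stmt-3819: `2·[B̄₄] − [D̄²]`) and
  `BallCalibrationSix` (stmt-11797: `6·[B̄₆] − [D̄³]`) VERBATIM;
* `archimedes` — `3 · ⟦B̄₃⟧ = 4 · ⟦π⟧` (Archimedes' sphere-and-cylinder, inside the rules).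

Design: no definitions. References: M. Kontsevich, D. Zagier, *Periods* (2001), §§1.2, 4.1; Archimedes, *On the Sphere and
Cylinder* I.34.
-/

noncomputable section

namespace Summit.KontsevichZagierPeriods.InverseLandau

open MeasureTheory Set
open Literature.NumberTheory.Transcendental

/-- **EVEN BALLS INSIDE THE RULES**: `k! · ⟦B̄₂ₖ⟧ = ⟦π⟧ᵏ` in the formal period ring, unconditionally (stubs 62 + 63).
[cite: KontsevichZagier2001, §1.2] -/
theorem ballEven (k : ℕ) (b : KZ.IntegralRep (2 * k)) (hb : b.domain = {v | ∑ j, v j ^ 2 ≤ 1})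
    (hbi : ∀ v ∈ b.domain, b.integrand v = 1) :
    (Nat.factorial k : KZ.FormalPeriodRing) * KZ.toFormalPeriod (KZ.of b) = KZ.toFormalPeriod (KZ.of KZ.piRep) ^ k :=
  tateLifting_ballEven tateLifting_ballValue.1 k b hb hbi

/-- **ODD BALLS INSIDE THE RULES**: `(2k+1)‼ · ⟦B̄₂ₖ₊₁⟧ = 2ᵏ⁺¹ · ⟦π⟧ᵏ` in the formal period ring, unconditionally (stubs 62 + 64).
[cite: KontsevichZagier2001, §1.2] -/
theorem ballOdd (k : ℕ) (b : KZ.IntegralRep (2 * k + 1)) (hb : b.domain = {v | ∑ j, v j ^ 2 ≤ 1})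
    (hbi : ∀ v ∈ b.domain, b.integrand v = 1) :
    (Nat.doubleFactorial (2 * k + 1) : KZ.FormalPeriodRing) * KZ.toFormalPeriod (KZ.of b) =
      2 ^ (k + 1) * KZ.toFormalPeriod (KZ.of KZ.piRep) ^ k :=
  tateLifting_ballOdd tateLifting_ballValue.2 k b hb hbi

/-- **THE POLYDISC HAS THE CLASS `⟦π⟧ᵏ`** (stub 65, renamed for the assembly). [cite: KontsevichZagier2001, §4.1] -/
theorem polydiscPow (k : ℕ) (p : KZ.IntegralRep (2 * k))
    (hp : p.domain = {v | ∀ i : Fin k, v ⟨2 * (i : ℕ), by omega⟩ ^ 2 + v ⟨2 * (i : ℕ) + 1, by omega⟩ ^ 2 ≤ 1})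
    (hpi : ∀ v ∈ p.domain, p.integrand v = 1) :
    KZ.toFormalPeriod (KZ.of p) = KZ.toFormalPeriod (KZ.of KZ.piRep) ^ k :=
  tateLifting_polydiscPow k p hp hpi

/-- **`k! · [B̄₂ₖ] − [D̄ᵏ] ∈ KZ.relations` for every `k`**: the closed unit ball of `ℝ²ᵏ` against the closed polydisc, inside
the rules (`vol B̄₂ₖ = πᵏ/k!`). [cite: KontsevichZagier2001, §1.2] -/
theorem ballPolydisc :
    ∀ (k : ℕ) (b : KZ.IntegralRep (2 * k)), b.domain = {v | ∑ j, v j ^ 2 ≤ 1} →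
    (∀ v ∈ b.domain, b.integrand v = 1) → ∀ (p : KZ.IntegralRep (2 * k)),
    p.domain = {v | ∀ i : Fin k, v ⟨2 * (i : ℕ), by omega⟩ ^ 2 + v ⟨2 * (i : ℕ) + 1, by omega⟩ ^ 2 ≤ 1} →
    (∀ v ∈ p.domain, p.integrand v = 1) →
    (Nat.factorial k) • KZ.of b - KZ.of p ∈ KZ.relations := by
  intro k b hb hbi p hp hpi
  rw [← KZ.toFormalPeriod_eq_zero_iff, map_sub, map_nsmul, polydiscPow k p hp hpi, ← ballEven k b hb hbi, nsmul_eq_mul,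
    sub_self]

/-- **Route EulerFormChain's `BallCalibration` (stmt-KontsevichZagierPeriods-3819), VERBATIM**: `2·[B̄₄] − [D̄ × D̄] ∈ relations`
(`vol₄ B̄₄ = π²/2`; no fibrewise scaling or half-angle map needed: Lindemann read in the formal period ring does it).
[cite: KontsevichZagier2001, §1.2] -/
theorem ballCalibration :
    ∀ (b : KZ.IntegralRep 4), b.domain = {v | ∑ j, v j ^ 2 ≤ 1} → (∀ v ∈ b.domain, b.integrand v = 1) →
      ∀ (p : KZ.IntegralRep 4), p.domain = {v | v 0 ^ 2 + v 1 ^ 2 ≤ 1 ∧ v 2 ^ 2 + v 3 ^ 2 ≤ 1} →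
        (∀ v ∈ p.domain, p.integrand v = 1) → (2 : ℕ) • KZ.of b - KZ.of p ∈ KZ.relations := by
  intro b hb hbi p hp hpi
  have h := ballPolydisc 2 b hb hbi p ?_ hpi
  · simpa [Nat.factorial] using h
  · rw [hp]
    ext v
    simp only [Set.mem_setOf_eq, Fin.forall_fin_two, Fin.isValue, Fin.val_zero, Fin.val_one, mul_zero, mul_one, zero_add]
    exact Iff.rfl

/-- **Route EulerFormChain's `BallCalibrationSix` (stmt-KontsevichZagierPeriods-11797), VERBATIM**: `6·[B̄₆] − [D̄³] ∈ relations`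
(`vol₆ B̄₆ = π³/6`). [cite: KontsevichZagier2001, §1.2] -/
theorem ballCalibrationSix :
    ∀ (b : KZ.IntegralRep 6), b.domain = {v | ∑ j, v j ^ 2 ≤ 1} → (∀ v ∈ b.domain, b.integrand v = 1) →
      ∀ (p : KZ.IntegralRep 6), p.domain = {v | v 0 ^ 2 + v 1 ^ 2 ≤ 1 ∧ v 2 ^ 2 + v 3 ^ 2 ≤ 1 ∧ v 4 ^ 2 + v 5 ^ 2 ≤ 1} →
        (∀ v ∈ p.domain, p.integrand v = 1) → (6 : ℕ) • KZ.of b - KZ.of p ∈ KZ.relations := by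
  intro b hb hbi p hp hpi
  have h := ballPolydisc 3 b hb hbi p ?_ hpi
  · simpa [Nat.factorial] using h
  · rw [hp]
    ext v
    simp only [Set.mem_setOf_eq, Fin.forall_fin_succ, Fin.isValue, Fin.val_zero, Fin.val_succ, mul_zero, mul_one,
      zero_add, IsEmpty.forall_iff, and_true]
    all_goals exact Iff.rfl

/-- **ARCHIMEDES INSIDE THE RULES**: `3 · ⟦B̄₃⟧ = 4 · ⟦π⟧` in the formal period ring (the volume of the unit ball is `4π/3`, as an
identity derivable by the four moves). [cite: KontsevichZagier2001, §1.2] -/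
theorem archimedes (b : KZ.IntegralRep 3) (hb : b.domain = {v | ∑ j, v j ^ 2 ≤ 1}) (hbi : ∀ v ∈ b.domain, b.integrand v = 1) :
    (3 : KZ.FormalPeriodRing) * KZ.toFormalPeriod (KZ.of b) = 4 * KZ.toFormalPeriod (KZ.of KZ.piRep) := by
  have h := ballOdd 1 b hb hbi
  norm_num [Nat.doubleFactorial] at h
  exact h

end Summit.KontsevichZagierPeriods.InverseLandau

end
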